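import Summits.AtomisticToContinuum.Crystallization.Theorems.RepetitiveNetworkReductionRecurrentMemberEngine
import Summits.AtomisticToContinuum.Crystallization.Theorems.RepetitiveNetworkReductionRecurrentMemberLimits

/-!
# `NetworkRecurrenceTransfer` — the registered stub `stub_recurrentMember` (uniformly recurrent member), part 4/4

Registered stub `stub_recurrentMember` of `NetworkRecurrenceTransfer` (RED, `stmt-AtomisticToContinuum-27236`,
route `RepetitiveNetworkReduction`, sub-problem `Crystallization` of `AtomisticToContinuum`); file of record written by
the decomp-a2c cell's lens-2 g17 seat (v2, sha256 f8100bfc…, 1163 lines, one namespace), SPLIT VERBATIM into four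
modules ≤ 400 lines for the tree's file-size lint by hand-1 g5 (declarations, statements and proofs byte-identical;
only imports / module docstrings differ):
* `RepetitiveNetworkReductionRecurrentMemberEngine` — matching calculus + the hull engine `exists_mem_uniformlyRecurrent`;
* `RepetitiveNetworkReductionRecurrentMemberDefs` — the route's `let`s as definitions, the counting-measure dictionary,
  re-rooting invariance of the good class;
* `RepetitiveNetworkReductionRecurrentMemberLimits` — far tails, convergence of field sums, closure of `Appr` / Nash
  under rooted local limits;
* `RepetitiveNetworkReductionRecurrentMember` — closure of `IsMuGSC`, `goodClass_closed`, assembly and the stub BY NAME.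

> `stub_recurrentMember`: for every `δ > 0`, radii `R₇ R₈ R₉` and measure `μ` on `ℝ³` which is a rooted
> `δ`-hard-core counting measure, textured (`Appr μ R₇ R₈ R₉`), Nash (`NashM μ`) and an `e⋆`-μGSC of `V_LJ` on its
> atom set (`MuG μ`), there is a rooted `δ`-hard-core counting measure `ν` with the same three properties whose
> atom set is UNIFORMLY RECURRENT (`UR`): every patch of `supp ν` reappears, up to `ε`, within a bounded distance
> `G(R, ε)` of every atom.

This part: closure of the μGSC clause under rooted local limits (`isMuGSC_of_limit`), `goodClass_closed`, the assembly
`recurrentMember_core` (`μ = count|S` with `S ∈ goodClass` by the dictionary; the engine `exists_mem_uniformlyRecurrent`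
of part 1 gives a uniformly recurrent `Z ∈ goodClass`; `ν := count|Z`) and `stub_recurrentMember` with the registered
text verbatim. All statements are over existing declarations; no new axioms, no placeholders. All `[folklore]`.
-/


noncomputable section

open scoped BigOperators Topology
open Filter Set Metric MeasureTheory

namespace Summit.AtomisticToContinuum.Crystallization.Theorems.RepetitiveNetworkReductionRecurrentMember

open Literature.MathematicalPhysics.StatisticalMechanics
open Literature.Probability.Process (count_restrict_singleton_ne_zero_iff)
open Summit.AtomisticToContinuum.Crystallization.Theorems.LocalLimitStable

/-- **The renormalised finite-modification inequalities (`IsMuGSC`) pass to local limits of separated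
configurations.** [folklore] Match the removed atoms `xf i` to atoms `x_m i` of near approximants (the inserted
atoms `R j` are kept), apply the inequality there, and pass to the limit: the finite interaction energies converge by
continuity of `V_LJ` off `0`, the field sums by `tendsto_tsum_lennardJones_of_matched`. -/
theorem isMuGSC_of_limit {δ : ℝ} (hδ : 0 < δ) {Zs : ℕ → Set (EuclideanSpace ℝ (Fin 3))}
    (hZsep : ∀ k, ∀ p ∈ Zs k, ∀ q ∈ Zs k, p ≠ q → δ ≤ dist p q)
    (hZM : ∀ k, IsMuGSC lennardJones eStar (Zs k))
    {Z : Set (EuclideanSpace ℝ (Fin 3))} (hsep : ∀ p ∈ Z, ∀ q ∈ Z, p ≠ q → δ ≤ dist p q)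
    (hconv : ∀ R ε : ℝ, 0 < ε → ∀ᶠ k in atTop, BallMatch ε R 0 (Zs k) Z) : IsMuGSC lennardJones eStar Z := by
  classical
  refine ⟨fun r => UniformlyDiscrete.summable_lennardJones_dist ⟨δ, hδ, hsep⟩ r, ?_⟩
  intro n xf hxf hxfZ k R hR hdisj
  have hε : ∀ m : ℕ, (0 : ℝ) < 1 / ((m : ℝ) + 1) := fun m => by positivity
  -- a common bound on the norms of the finitely many points involved
  set M : ℝ := ∑ i, ‖xf i‖ + ∑ j, ‖R j‖ with hM
  have hMx : ∀ i, ‖xf i‖ ≤ M := fun i => by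
    have h1 : ‖xf i‖ ≤ ∑ i, ‖xf i‖ := Finset.single_le_sum (fun i _ => norm_nonneg (xf i)) (Finset.mem_univ i)
    have h2 : (0 : ℝ) ≤ ∑ j, ‖R j‖ := Finset.sum_nonneg fun j _ => norm_nonneg _
    linarith
  have hMR : ∀ j, ‖R j‖ ≤ M := fun j => by
    have h1 : ‖R j‖ ≤ ∑ j, ‖R j‖ := Finset.single_le_sum (fun j _ => norm_nonneg (R j)) (Finset.mem_univ j)
    have h2 : (0 : ℝ) ≤ ∑ i, ‖xf i‖ := Finset.sum_nonneg fun i _ => norm_nonneg _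
    linarith
  obtain ⟨κ, hκ⟩ : ∃ κ : ℕ → ℕ, ∀ m : ℕ, BallMatch (1 / ((m : ℝ) + 1)) ((m : ℝ) + M + 1) 0 (Zs (κ m)) Z :=
    ⟨fun m => (hconv ((m : ℝ) + M + 1) _ (hε m)).exists.choose,
      fun m => (hconv ((m : ℝ) + M + 1) _ (hε m)).exists.choose_spec⟩
  have hrad : ∀ m : ℕ, ∀ c q : EuclideanSpace ℝ (Fin 3), ‖c‖ ≤ M → dist q c ≤ m →
      dist q (0 : EuclideanSpace ℝ (Fin 3)) ≤ (m : ℝ) + M + 1 := by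
    intro m c q hc hqc
    have h1 := dist_triangle q c (0 : EuclideanSpace ℝ (Fin 3))
    have e1 : dist c (0 : EuclideanSpace ℝ (Fin 3)) = ‖c‖ := dist_zero_right _
    linarith
  have hx0 : ∀ m : ℕ, ∀ i, dist (xf i) (0 : EuclideanSpace ℝ (Fin 3)) ≤ (m : ℝ) + M + 1 := fun m i =>
    hrad m (xf i) (xf i) (hMx i) (by rw [dist_self]; exact Nat.cast_nonneg m)
  obtain ⟨x, hxZ, hxd⟩ : ∃ x : ℕ → Fin n → EuclideanSpace ℝ (Fin 3), (∀ m i, x m i ∈ Zs (κ m)) ∧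
      ∀ (m : ℕ) i, dist (x m i) (xf i) ≤ 1 / ((m : ℝ) + 1) := by
    choose x h1 h2 using fun (m : ℕ) (i : Fin n) => (hκ m).1 (xf i) (hxfZ ⟨i, rfl⟩) (hx0 m i)
    exact ⟨x, h1, h2⟩
  -- inserted atoms outside `Z` are eventually outside the approximants
  have hRout : ∀ᶠ m : ℕ in atTop, ∀ j, R j ∉ Z → R j ∉ Zs (κ m) := by
    rw [Filter.eventually_all]
    intro j
    by_cases hj : R j ∈ Z
    · exact Filter.Eventually.of_forall fun m h => (h hj).elim
    · obtain ⟨ρ, hρ, hρZ⟩ := exists_pos_le_dist_of_not_mem hδ hsep hj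
      filter_upwards [(tendsto_one_div_add_atTop_nhds_zero_nat.eventually (gt_mem_nhds hρ))] with m hm _ hRj
      obtain ⟨s, hs, hds⟩ := (hκ m).2 (R j) hRj (hrad m (R j) (R j) (hMR j) (by
        rw [dist_self]; exact Nat.cast_nonneg m))
      have := hρZ s hs
      linarith
  -- the inequality at stage `m`, eventually
  have hstage : ∀ᶠ m : ℕ in atTop,
      interactionEnergy lennardJones (x m) +
          (∑ i, ∑' q : ↥(Zs (κ m) \ Set.range (x m)), lennardJones (dist (x m i) (q : EuclideanSpace ℝ (Fin 3)))) -
          eStar * n ≤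
        interactionEnergy lennardJones R +
          (∑ i, ∑' q : ↥(Zs (κ m) \ Set.range (x m)), lennardJones (dist (R i) (q : EuclideanSpace ℝ (Fin 3)))) -
          eStar * k := by
    filter_upwards [(tendsto_one_div_add_atTop_nhds_zero_nat.eventually (gt_mem_nhds (half_pos hδ))), hRout] with m hm hmR
    have hmδ : 2 * (1 / ((m : ℝ) + 1)) < δ := by linarith
    have hxinj : Function.Injective (x m) := by
      intro i i' h
      by_contra hne
      have h1 := hsep (xf i) (hxfZ ⟨i, rfl⟩) (xf i') (hxfZ ⟨i', rfl⟩) (hxf.ne hne)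
      have : dist (xf i) (xf i') ≤ 2 * (1 / ((m : ℝ) + 1)) :=
        calc dist (xf i) (xf i') ≤ dist (x m i) (xf i) + dist (x m i) (xf i') := dist_triangle_left _ _ _
          _ = dist (x m i) (xf i) + dist (x m i') (xf i') := by rw [h]
          _ ≤ 1 / ((m : ℝ) + 1) + 1 / ((m : ℝ) + 1) := add_le_add (hxd m i) (hxd m i')
          _ = 2 * (1 / ((m : ℝ) + 1)) := by ring
      linarith
    have hxr : Set.range (x m) ⊆ Zs (κ m) := by
      rintro _ ⟨i, rfl⟩; exact hxZ m i
    have hdisj' : Disjoint (Set.range R) (Zs (κ m) \ Set.range (x m)) := by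
      rw [Set.disjoint_left]
      rintro _ ⟨j, rfl⟩ ⟨hRjZs, hRjx⟩
      by_cases hRjZ : R j ∈ Z
      · have hRjxf : R j ∈ Set.range xf := by
          by_contra hnot
          exact (Set.disjoint_left.1 hdisj) ⟨j, rfl⟩ ⟨hRjZ, hnot⟩
        obtain ⟨i, hi⟩ := hRjxf
        apply hRjx
        refine ⟨i, ?_⟩
        by_contra hne
        have h1 := hZsep (κ m) (x m i) (hxZ m i) (R j) hRjZs hne
        have h2 : dist (x m i) (R j) ≤ 1 / ((m : ℝ) + 1) := by rw [← hi]; exact hxd m i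
        linarith [hε m]
      · exact hmR j hRjZ hRjZs
    exact (hZM (κ m)).2 n (x m) hxinj hxr k R hR hdisj'
  -- two-way matching of the rests about any centre of norm `≤ M`
  have hX'sep : ∀ a ∈ Z \ Set.range xf, ∀ b ∈ Z \ Set.range xf, a ≠ b → δ ≤ dist a b :=
    fun a ha b hb hab => hsep a ha.1 b hb.1 hab
  have hTsep : ∀ m, ∀ a ∈ Zs (κ m) \ Set.range (x m), ∀ b ∈ Zs (κ m) \ Set.range (x m), a ≠ b → δ ≤ dist a b :=
    fun m a ha b hb hab => hZsep _ a ha.1 b hb.1 hab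
  have hmatch : ∀ c : EuclideanSpace ℝ (Fin 3), ‖c‖ ≤ M → ∀ R' e : ℝ, 0 < e → ∀ᶠ m : ℕ in atTop,
      (∀ q ∈ Z \ Set.range xf, dist q c ≤ R' → ∃ q' ∈ Zs (κ m) \ Set.range (x m), dist q' q ≤ e) ∧
        (∀ q' ∈ Zs (κ m) \ Set.range (x m), dist q' c ≤ R' → ∃ q ∈ Z \ Set.range xf, dist q' q ≤ e) := by
    intro c hc R' e he
    filter_upwards [(tendsto_one_div_add_atTop_nhds_zero_nat.eventually (gt_mem_nhds (lt_min he (half_pos hδ)))), (tendsto_natCast_atTop_atTop.eventually_ge_atTop R')] with m hm1 hm2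
    have hme : 1 / ((m : ℝ) + 1) ≤ e := (hm1.trans_le (min_le_left _ _)).le
    have hmδ : 2 * (1 / ((m : ℝ) + 1)) < δ := by
      have := hm1.trans_le (min_le_right _ _); linarith
    refine ⟨fun q hq hqc => ?_, fun q' hq' hq'c => ?_⟩
    · obtain ⟨q', hq', hq'q⟩ := (hκ m).1 q hq.1 (hrad m c q hc (hqc.trans hm2))
      have hne : q' ∉ Set.range (x m) := by
        rintro ⟨i, rfl⟩
        have hqx : q ≠ xf i := fun h => hq.2 ⟨i, h.symm⟩
        have h3 := hsep q hq.1 (xf i) (hxfZ ⟨i, rfl⟩) hqx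
        have : dist q (xf i) ≤ 2 * (1 / ((m : ℝ) + 1)) :=
          calc dist q (xf i) ≤ dist (x m i) q + dist (x m i) (xf i) := dist_triangle_left _ _ _
            _ ≤ 1 / ((m : ℝ) + 1) + 1 / ((m : ℝ) + 1) := add_le_add hq'q (hxd m i)
            _ = 2 * (1 / ((m : ℝ) + 1)) := by ring
        linarith
      exact ⟨q', ⟨hq', hne⟩, hq'q.trans hme⟩
    · obtain ⟨q, hq, hq'q⟩ := (hκ m).2 q' hq'.1 (hrad m c q' hc (hq'c.trans hm2))
      have hqx : q ∉ Set.range xf := by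
        rintro ⟨i, rfl⟩
        have hne : q' ≠ x m i := fun h => hq'.2 ⟨i, h.symm⟩
        have h3 := hZsep (κ m) q' hq'.1 (x m i) (hxZ m i) hne
        have : dist q' (x m i) ≤ 2 * (1 / ((m : ℝ) + 1)) :=
          calc dist q' (x m i) ≤ dist q' (xf i) + dist (x m i) (xf i) := dist_triangle_right _ _ _
            _ ≤ 1 / ((m : ℝ) + 1) + 1 / ((m : ℝ) + 1) := add_le_add hq'q (hxd m i)
            _ = 2 * (1 / ((m : ℝ) + 1)) := by ring
        linarith
      exact ⟨q, ⟨hq, hqx⟩, hq'q.trans hme⟩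
  -- limits
  have hxt : ∀ i, Tendsto (fun m => x m i) atTop (𝓝 (xf i)) := fun i =>
    tendsto_of_dist_le_one_div fun m => hxd m i
  have hIE : Tendsto (fun m => interactionEnergy lennardJones (x m)) atTop
      (𝓝 (interactionEnergy lennardJones xf)) := by
    simp only [interactionEnergy]
    refine tendsto_finsetSum _ fun i _ => tendsto_finsetSum _ fun j hj => ?_
    have hij : i ≠ j := (Finset.mem_Ioi.1 hj).ne
    have hd : dist (xf i) (xf j) ≠ 0 := dist_ne_zero.2 (hxf.ne hij)
    have hc : ContinuousAt lennardJones (dist (xf i) (xf j)) :=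
      continuousOn_lennardJones.continuousAt (isOpen_compl_singleton.mem_nhds hd)
    exact hc.tendsto.comp ((hxt i).dist (hxt j))
  have hF1 : ∀ i, Tendsto
      (fun m => ∑' q : ↥(Zs (κ m) \ Set.range (x m)), lennardJones (dist (x m i) (q : EuclideanSpace ℝ (Fin 3))))
      atTop (𝓝 (∑' q : ↥(Z \ Set.range xf), lennardJones (dist (xf i) (q : EuclideanSpace ℝ (Fin 3))))) := by
    intro i
    have hρ : ∀ q ∈ Z \ Set.range xf, δ ≤ dist (xf i) q :=
      fun q hq => hsep (xf i) (hxfZ ⟨i, rfl⟩) q hq.1 fun h => hq.2 ⟨i, h⟩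
    exact tendsto_tsum_lennardJones_of_matched hδ hX'sep hδ hρ hTsep (hxt i) (hmatch (xf i) (hMx i))
  have hF2 : ∀ j, Tendsto
      (fun m => ∑' q : ↥(Zs (κ m) \ Set.range (x m)), lennardJones (dist (R j) (q : EuclideanSpace ℝ (Fin 3))))
      atTop (𝓝 (∑' q : ↥(Z \ Set.range xf), lennardJones (dist (R j) (q : EuclideanSpace ℝ (Fin 3))))) := by
    intro j
    have hRj : R j ∉ Z \ Set.range xf := fun h => (Set.disjoint_left.1 hdisj) ⟨j, rfl⟩ h
    obtain ⟨ρ, hρ, hρX⟩ := exists_pos_le_dist_of_not_mem hδ hX'sep hRj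
    exact tendsto_tsum_lennardJones_of_matched hδ hX'sep hρ hρX hTsep tendsto_const_nhds (hmatch (R j) (hMR j))
  have hL := (hIE.add (tendsto_finsetSum Finset.univ fun i _ => hF1 i)).sub
    (tendsto_const_nhds : Tendsto (fun _ : ℕ => eStar * (n : ℝ)) atTop (𝓝 (eStar * n)))
  have hRl := ((tendsto_const_nhds : Tendsto (fun _ : ℕ => interactionEnergy lennardJones R) atTop
      (𝓝 (interactionEnergy lennardJones R))).add (tendsto_finsetSum Finset.univ fun j _ => hF2 j)).sub
    (tendsto_const_nhds : Tendsto (fun _ : ℕ => eStar * (k : ℝ)) atTop (𝓝 (eStar * k)))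
  exact le_of_tendsto_of_tendsto hL hRl hstage

/-- **The class `goodClass δ R₇ R₈ R₉` is closed under rooted local limits** (the `hclosed` hypothesis of the hull
engine). [folklore] -/
theorem goodClass_closed {δ R₇ R₈ R₉ : ℝ} (hδ : 0 < δ) (Zs : ℕ → Set (EuclideanSpace ℝ (Fin 3)))
    (hZs : ∀ k, Zs k ∈ goodClass δ R₇ R₈ R₉) (Z : Set (EuclideanSpace ℝ (Fin 3)))
    (h0 : (0 : EuclideanSpace ℝ (Fin 3)) ∈ Z) (hsep : ∀ p ∈ Z, ∀ q ∈ Z, p ≠ q → δ ≤ dist p q)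
    (hconv : ∀ R ε : ℝ, 0 < ε → ∀ᶠ k in Filter.atTop, BallMatch ε R 0 (Zs k) Z) :
    Z ∈ goodClass δ R₇ R₈ R₉ :=
  ⟨h0, hsep, apprS_of_limit (fun k => (hZs k).2.2.1) h0 hconv,
    nashS_of_limit hδ (fun k => (hZs k).2.1) (fun k => (hZs k).2.2.2.1) hsep hconv,
    isMuGSC_of_limit hδ (fun k => (hZs k).2.1) (fun k => (hZs k).2.2.2.2) hsep hconv⟩

/-! ## Assembly -/

/-- The core of `stub_recurrentMember` at set level: a member of `goodClass δ R₇ R₈ R₉` yields a UNIFORMLY RECURRENT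
member (`URS`), by the hull engine `exists_mem_uniformlyRecurrent` applied to the re-rooting invariant, local-limit closed class
`goodClass`. [folklore] -/
theorem recurrentMember_core {δ R₇ R₈ R₉ : ℝ} (hδ : 0 < δ) {S : Set (EuclideanSpace ℝ (Fin 3))}
    (hS : S ∈ goodClass δ R₇ R₈ R₉) : ∃ Z ∈ goodClass δ R₇ R₈ R₉, URS Z := by
  obtain ⟨Z, hZ, hUR⟩ := exists_mem_uniformlyRecurrent δ hδ (goodClass δ R₇ R₈ R₉) ⟨S, hS⟩ (fun Z hZ => hZ.2.1)
    (fun Z hZ => hZ.1) (fun Z hZ z hz => goodClass_image_sub hδ hZ hz) (goodClass_closed hδ)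
  refine ⟨Z, hZ, fun R ε hε => ?_⟩
  obtain ⟨G, hG⟩ := hUR R ε hε
  refine ⟨G, fun w hw => ?_⟩
  obtain ⟨g, hg, hgw, hbm⟩ := hG w hw
  refine ⟨g, hg, hgw, fun s hs hsR => ?_, fun a ha haR => ?_⟩
  · obtain ⟨_, ⟨a, ha, rfl⟩, has⟩ := hbm.1 s hs hsR
    exact ⟨a, ha, has⟩
  · obtain ⟨s, hs, has⟩ := hbm.2 (a - g) ⟨a, ha, rfl⟩ haR
    exact ⟨s, hs, has⟩

/-- **`stub_recurrentMember`** (registered stub of `NetworkRecurrenceTransfer`, by name and text): a rooted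
`δ`-hard-core counting measure on `ℝ³` which is textured, Nash and an `e⋆`-μGSC of `V_LJ` can be replaced by one with
the same properties whose atom set is uniformly recurrent. -/
theorem stub_recurrentMember : ∀ δ : ℝ, 0 < δ → ∀ R₇ R₈ R₉ : ℝ, ∀ μ : MeasureTheory.Measure (EuclideanSpace ℝ (Fin 3)), let Gy : ℝ → (N : ℕ) → (Fin N → EuclideanSpace ℝ (Fin 3)) → Fin N → Prop := fun η N y j => let d : ℝ := sInf ((fun z => dist z (y (j : Fin N))) '' (Set.range (y) \ {(y (j : Fin N))})); let T : Set (EuclideanSpace ℝ (Fin 3)) := {z : EuclideanSpace ℝ (Fin 3) | z ∈ Set.range (y) ∧ z ≠ (y (j : Fin N)) ∧ dist z (y (j : Fin N)) < 13 / 10 * d}; ∃ A : EuclideanSpace ℝ (Fin 3) →ₗᵢ[ℝ] EuclideanSpace ℝ (Fin 3), (∃ e : ↥T ≃ ↥Literature.Geometry.DiscreteGeometry.fccKissingPattern, ∀ t : ↥T, dist (d⁻¹ • ((t : EuclideanSpace ℝ (Fin 3)) - (y (j : Fin N)))) (A ((e t : ↥Literature.Geometry.DiscreteGeometry.fccKissingPattern)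 : EuclideanSpace ℝ (Fin 3))) ≤ η) ∨ (∃ e : ↥T ≃ ↥Literature.Geometry.DiscreteGeometry.hcpKissingPattern, ∀ t : ↥T, dist (d⁻¹ • ((t : EuclideanSpace ℝ (Fin 3)) - (y (j : Fin N)))) (A ((e t : ↥Literature.Geometry.DiscreteGeometry.hcpKissingPattern) : EuclideanSpace ℝ (Fin 3))) ≤ η); let TexBall : (N : ℕ) → (Fin N → EuclideanSpace ℝ (Fin 3)) → Fin N → ℝ → ℝ → ℝ → ℝ → Prop := fun N y i R R₇ R₈ R₉ => (∀ a b : Fin N, a ≠ b → (7 : ℝ) / 10 ≤ dist (y a) (y b)) ∧ (∀ j : Fin N, dist (y j) (y i) ≤ R → ¬ Gy (1 / 20) N (y) j) ∧ (∀ j : Fin N, dist (y j) (y i) ≤ R → ¬ ((∀ j' : Fin N, dist (y j') (y j) ≤ R₇ → ¬ Gy (1 / 20) N (y) j') ∧ (∀ z : EuclideanSpace ℝ (Fin 3), dist z (y j) ≤ R₇ → ∃ k : Fin N, dist z (y k) ≤ 1) ∧ (∀ j' : Fin N, dist (y j') (y j) ≤ R₇ → (let d : ℝ := sInf ((fun z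 => dist z (y j')) '' (Set.range (y) \ {(y j')})); ∀ k : Fin N, y k ≠ y j' → dist (y k) (y j') < 27 / 20 * d → 5 ≤ Nat.card {m : Fin N // y m ≠ y j' ∧ dist (y m) (y j') < 27 / 20 * d ∧ y m ≠ y k ∧ dist (y m) (y k) < 27 / 20 * d})))) ∧ (∀ j : Fin N, dist (y j) (y i) ≤ R → ∃ k : Fin N, dist (y k) (y j) ≤ R₈ ∧ Gy (1 / 8) N (y) k) ∧ (∀ j : Fin N, dist (y j) (y i) ≤ R → ¬ ((∀ j' : Fin N, dist (y j') (y j) ≤ R₉ → ¬ Gy (1 / 20) N (y) j') ∧ (Nat.card {j' : Fin N // dist (y j') (y j) ≤ R₉ ∧ ¬ Gy (1 / 8) N (y) j'} : ℝ) ≤ 1 / 2 * (Nat.card {j' : Fin N // dist (y j') (y j) ≤ R₉} : ℝ) ∧ (∀ j' : Fin N, dist (y j') (y j) ≤ R₉ → ¬ Gy (1 / 8) N (y) j' → ¬ (let d : ℝ := sInf ((fun z => dist z (y j')) '' (Set.range (y) \ {(y j')})); ∀ k : Fin N, y k ≠ y j' → dist (y k) (y j') < 27 / 20 * d → 5 ≤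 Nat.card {m : Fin N // y m ≠ y j' ∧ dist (y m) (y j') < 27 / 20 * d ∧ y m ≠ y k ∧ dist (y m) (y k) < 27 / 20 * d})))); let Appr : MeasureTheory.Measure (EuclideanSpace ℝ (Fin 3)) → ℝ → ℝ → ℝ → Prop := fun μ R₇ R₈ R₉ => ∀ q : EuclideanSpace ℝ (Fin 3), μ {q} ≠ 0 → ∀ R ε : ℝ, 0 < ε → ∃ (N : ℕ) (y : Fin N → EuclideanSpace ℝ (Fin 3)) (i : Fin N), TexBall N y i R R₇ R₈ R₉ ∧ (∀ p : EuclideanSpace ℝ (Fin 3), μ {p} ≠ 0 → dist p q ≤ R → ∃ k : Fin N, dist (y k - y i) (p - q) ≤ ε) ∧ (∀ k : Fin N, dist (y k) (y i) ≤ R → ∃ p : EuclideanSpace ℝ (Fin 3), μ {p} ≠ 0 ∧ dist (y k - y i) (p - q) ≤ ε); let AtomS : MeasureTheory.Measure (EuclideanSpace ℝ (Fin 3)) → Set (EuclideanSpace ℝ (Fin 3)) := fun μ => {p : EuclideanSpace ℝ (Fin 3) | μ {p} ≠ 0}; let NashM : MeasureTheory.Measure (EuclideanSpace ℝ (Fin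 3)) → Prop := fun μ => ∀ p : EuclideanSpace ℝ (Fin 3), μ {p} ≠ 0 → ∀ y : EuclideanSpace ℝ (Fin 3), (∀ q : EuclideanSpace ℝ (Fin 3), μ {q} ≠ 0 → q ≠ p → y ≠ q) → ∑' q : {q : EuclideanSpace ℝ (Fin 3) // μ {q} ≠ 0 ∧ q ≠ p}, Literature.MathematicalPhysics.StatisticalMechanics.lennardJones (dist p (q : EuclideanSpace ℝ (Fin 3))) ≤ ∑' q : {q : EuclideanSpace ℝ (Fin 3) // μ {q} ≠ 0 ∧ q ≠ p}, Literature.MathematicalPhysics.StatisticalMechanics.lennardJones (dist y (q : EuclideanSpace ℝ (Fin 3))); let MuG : MeasureTheory.Measure (EuclideanSpace ℝ (Fin 3)) → Prop := fun μ => ((∀ r : EuclideanSpace ℝ (Fin 3), Summable fun y : ↥((AtomS μ)) => Literature.MathematicalPhysics.StatisticalMechanics.lennardJones (dist r y)) ∧ ∀ (n : ℕ) (xf : Fin n → EuclideanSpace ℝ (Fin 3)), Function.Injective xf → Set.range xf ⊆ (AtomS μ) → ∀ (k : ℕ) (R : Fin k → EuclideanSpace ℝ (Fin 3)), Function.Injective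 R → Disjoint (Set.range R) ((AtomS μ) \ Set.range xf) → Literature.MathematicalPhysics.StatisticalMechanics.interactionEnergy Literature.MathematicalPhysics.StatisticalMechanics.lennardJones xf + (∑ i, ∑' y : ↥((AtomS μ) \ Set.range xf), Literature.MathematicalPhysics.StatisticalMechanics.lennardJones (dist (xf i) y)) - (⨅ Q : Literature.MathematicalPhysics.StatisticalMechanics.PeriodicConfiguration 3, Q.energyPerParticle Literature.MathematicalPhysics.StatisticalMechanics.lennardJones) * n ≤ Literature.MathematicalPhysics.StatisticalMechanics.interactionEnergy Literature.MathematicalPhysics.StatisticalMechanics.lennardJones R + (∑ i, ∑' y : ↥((AtomS μ) \ Set.range xf), Literature.MathematicalPhysics.StatisticalMechanics.lennardJones (dist (R i) y)) - (⨅ Q : Literature.MathematicalPhysics.StatisticalMechanics.PeriodicConfiguration 3, Q.energyPerParticle Literature.MathematicalPhysics.StatisticalMechanics.lennardJones) * k); let UR : Set (EuclideanSpace ℝ (Fin 3)) → Prop := fun S => ∀ R ε : ℝ, 0 < ε → ∃ G : ℝ, ∀ w ∈ S, ∃ g ∈ S, dist g w ≤ G ∧ (∀ s ∈ S, dist s (0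 : EuclideanSpace ℝ (Fin 3)) ≤ R → ∃ a ∈ S, dist (a - g) s ≤ ε) ∧ (∀ a ∈ S, dist (a - g) (0 : EuclideanSpace ℝ (Fin 3)) ≤ R → ∃ s ∈ S, dist (a - g) s ≤ ε); Literature.Probability.Process.IsRootedHardCore δ μ → Appr μ R₇ R₈ R₉ → NashM μ → MuG μ → ∃ ν : MeasureTheory.Measure (EuclideanSpace ℝ (Fin 3)), Literature.Probability.Process.IsRootedHardCore δ ν ∧ Appr ν R₇ R₈ R₉ ∧ NashM ν ∧ MuG ν ∧ UR (AtomS ν) := by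
  intro δ hδ R₇ R₈ R₉ μ
  dsimp only
  intro hHC hA hN hM
  obtain ⟨S, h0S, hSsep, rfl⟩ := hHC
  have hA' : ApprM ((Measure.count : Measure (EuclideanSpace ℝ (Fin 3))).restrict S) R₇ R₈ R₉ := hA
  have hN' : NashM ((Measure.count : Measure (EuclideanSpace ℝ (Fin 3))).restrict S) := hN
  have hM' : MuGM ((Measure.count : Measure (EuclideanSpace ℝ (Fin 3))).restrict S) := hM
  have hS : S ∈ goodClass δ R₇ R₈ R₉ :=
    ⟨h0S, hSsep, (apprM_iff S R₇ R₈ R₉).1 hA', (nashM_iff S).1 hN', (muGM_iff S).1 hM'⟩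
  obtain ⟨Z, hZ, hUR⟩ := recurrentMember_core hδ hS
  have hA2 : ApprM ((Measure.count : Measure (EuclideanSpace ℝ (Fin 3))).restrict Z) R₇ R₈ R₉ :=
    (apprM_iff Z R₇ R₈ R₉).2 hZ.2.2.1
  have hN2 : NashM ((Measure.count : Measure (EuclideanSpace ℝ (Fin 3))).restrict Z) := (nashM_iff Z).2 hZ.2.2.2.1
  have hM2 : MuGM ((Measure.count : Measure (EuclideanSpace ℝ (Fin 3))).restrict Z) := (muGM_iff Z).2 hZ.2.2.2.2
  have hU2 : URS {p : EuclideanSpace ℝ (Fin 3) |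
      (Measure.count : Measure (EuclideanSpace ℝ (Fin 3))).restrict Z {p} ≠ 0} := by
    have hZa : {p : EuclideanSpace ℝ (Fin 3) | (Measure.count : Measure (EuclideanSpace ℝ (Fin 3))).restrict Z {p} ≠ 0} = Z :=
      Set.ext fun p => count_restrict_singleton_ne_zero_iff Z p
    rw [hZa]; exact hUR
  exact ⟨(Measure.count : Measure (EuclideanSpace ℝ (Fin 3))).restrict Z, ⟨Z, hZ.1, hZ.2.1, rfl⟩, hA2, hN2, hM2, hU2⟩


end Summit.AtomisticToContinuum.Crystallization.Theorems.RepetitiveNetworkReductionRecurrentMember
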